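import Literature.Geometry.DiscreteGeometry.KissingArccosBrackets
import Literature.Geometry.DiscreteGeometry.TameContactGraphs
import Literature.Analysis.ValidatedNumerics.IntervalFunctions
import HarnessLib

/-!
# The growth-search checker for the contact graphs of kissing configurations (computable part)

Topic `Literature/Geometry/DiscreteGeometry`; provefact brick for `Hales2012_contactGraphTame` /
`Hales2012_contactGraphFccOrHcp` (`TameContactGraphs.lean`, `FejesTothKissingTwelve.lean`).
COMPUTABLE DEFINITIONS ONLY (nothing is asserted here).  The checker explores, by "disk growth",
every labelled fan triangulation of twelve points that is consistent with the local axioms of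
the fan-refined hull triangulation of a kissing configuration `V ∈ 𝒱` (Hales 2012, Def. 1) —
two triangles on every side, contacts are sides, at most `4` contacts at a point, at least `23`
contacts, `20` triangles, node equations `Σ angles = 2π`, the spherical law of cosines, the
circumradius bound, the rhombus cap, single-cycle vertex links — pruning with interval brackets
of the triangle angles over a grid of `K` cells of the cosine of a long side (`[-1/2, κ₀]`,
`κ₀ = 1031/5000`).  A surviving complete leaf is accepted only if its contact graph is, by an
explicitly verified bijection, the FCC or the HCP contact graph (`tameAdjM 1`, `tameAdjM 0`).
Semantics and soundness: `KissingSearchNumerics.lean`, `KissingSearchStructure.lean`,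
`KissingSearchRules.lean`, `KissingSearchNode.lean`, `KissingSearchRelabel.lean`,
`KissingSearchSearch.lean`, `KissingSearchRoot.lean` (main abstract theorem `concl_of_parts`); the
geometric dictionary `IsKissingConfig S → KConf`: `KissingSearchGeometry.lean`; the run (by
`native_decide`, computational lane): `KissingSearchRun*.lean`.

* Part A — numeric kernel: cells, the basic angle bracket `basic` of a triangle slot over a
  triple of cells (natural interval extension `RExpr.enclose` of the law-of-cosines quotient and
  of the circumradius polynomial, then the `arccos` ladder of `KissingArccosBrackets.lean`, unit
  `δ = 1/2048`), the tables `BTAB`, `T1TAB`, and range brackets `rangeBr`.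
* Part B — states (`St`: placed triangles, side domains, side counts), links, worklist
  propagation (`propagateWL`, `propagate`), leaf refutation (`refute`), the FCC/HCP recogniser
  (`isoTo`, `findIso`, `accept`), growth (`expand`, `kidsAt`, `Node`), the search `search`, the
  `14` root states `mkRoot`/`rootStates` (three triangles `{0,1,2}, {0,1,3}, {0,2,4}` at a vertex
  `0` with four contacts, `0–1`, `0–2` contacts), and the splitting of the run into parts
  (`stepAll`, `frontier`, `checkPart`, `checkAll`).

## References
* T. C. Hales, *A proof of Fejes Tóth's conjecture on sphere packings with kissing number
  twelve*, arXiv:1209.6043 (2012), Theorem 3, Lemmas 7–9. [`Hales2012`]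
* R. E. Moore, *Interval Analysis* (1966), Theorem 3.1, §4.4. [`Moore1966`]
-/

namespace Literature.Geometry.DiscreteGeometry

namespace KissingSearch

open Literature.Analysis.ValidatedNumerics KissingLP

/-! ### Part A. Numeric kernel -/

/-- Number of cells of the cosine grid of a long side. [folklore] -/
def K : ℕ := 15
/-- `κ₀ = 1031/5000`, the largest cosine of a long side (`dist ≥ 2h₀`). [cite: Hales2012, Definition 1] -/
def κ0 : ℚ := 1031 / 5000
/-- Grid point `j` (`j = 0 … K`): `-1/2 + j (κ₀ + 1/2)/K`. [folklore] -/
def gridPt (j : ℕ) : ℚ := -1 / 2 + (κ0 + 1 / 2) * j / K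
/-- A closed rational interval from two endpoints in either order. [folklore] -/
def mkIv (a b : ℚ) : NonemptyInterval ℚ := ⟨(min a b, max a b), min_le_max⟩
/-- The cosine interval of a side symbol: `0` = contact (`1/2`), `j = 1 … K` = cell
`[gridPt (j-1), gridPt j]`. [folklore] -/
def symIv (s : ℕ) : NonemptyInterval ℚ :=
  if s = 0 then mkIv (1 / 2) (1 / 2) else mkIv (gridPt (s - 1)) (gridPt s)

/-- Angle unit `δ = 1/2048` rad. [folklore] -/
def δ : ℚ := 1 / 2048
/-- Ladder length (`6435 δ > 3.1416`). [folklore] -/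
def NLAD : ℕ := 6435
/-- `12867 δ < 2π`. [folklore] -/
def TWOPI_LO : ℕ := 12867
/-- `2π < 12868 δ`. [folklore] -/
def TWOPI_HI : ℕ := 12868
/-- Working dyadic precision of the interval arithmetic. [folklore] -/
def PREC : ℕ := 40
/-- Heron iterations for square roots. [folklore] -/
def ITERS : ℕ := 8

/-- The law-of-cosines quotient `(z - x y) / (√(1-x²) √(1-y²))` (variables `0,1` = the two sides
at the vertex, `2` = the opposite side). [folklore] -/
def qExpr : RExpr :=
  .mul (.sub (.var 2) (.mul (.var 0) (.var 1)))
    (.inv (.mul (.sqrt (.sub (.const 1) (.sq (.var 0)))) (.sqrt (.sub (.const 1) (.sq (.var 1))))))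

/-- The circumradius polynomial
`P = 1 + 8xyz - 3(x²+y²+z²) + 2(x+y+z) - 2(xy+xz+yz)` (`P > 0` iff circumradius `< 60°`).
[folklore] -/
def pExpr : RExpr :=
  .sub (.add (.add (.const 1) (.mul (.const 8) (.mul (.var 0) (.mul (.var 1) (.var 2)))))
      (.mul (.const 2) (.add (.var 0) (.add (.var 1) (.var 2)))))
    (.add (.mul (.const 3) (.add (.sq (.var 0)) (.add (.sq (.var 1)) (.sq (.var 2)))))
      (.mul (.const 2) (.add (.mul (.var 0) (.var 1)) (.add (.mul (.var 0) (.var 2)) (.mul (.var 1) (.var 2))))))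

/-- The box of a symbol triple. [folklore] -/
def symBox (a b c : ℕ) : ℕ → NonemptyInterval ℚ :=
  fun i => if i = 0 then symIv a else if i = 1 then symIv b else symIv c

/-- A BRACKET is a natural number `16384 lo + hi + 1` (`hi < 16384`: the angle lies in
`[lo δ, hi δ]`), or `NOBR = 0` = infeasible / empty. [folklore] -/
def NOBR : ℕ := 0
/-- Make a bracket. [folklore] -/
def mkBr (lo hi : ℕ) : ℕ := 16384 * lo + hi + 1
/-- Lower end of a bracket. [folklore] -/
def brLo (br : ℕ) : ℕ := (br - 1) / 16384
/-- Upper end of a bracket. [folklore] -/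
def brHi (br : ℕ) : ℕ := (br - 1) % 16384
/-- Hull of two brackets (`NOBR` neutral). [folklore] -/
def brHull (x y : ℕ) : ℕ :=
  if x = NOBR then y else if y = NOBR then x else mkBr (min (brLo x) (brLo y)) (max (brHi x) (brHi y))

/-- Monotone form of the certificate `arccos q ≤ k δ`: test `arccosLeB` at `min (k δ) (13/5)`
(the polynomial bracket is only used on `[0, 13/5]`; a certificate at `13/5` serves every
larger angle).  Monotonicity in `k` is what makes the binary search of `ladUp` find the least
certified rung; soundness does not depend on it. [folklore] -/
def upOK (q : ℚ) (k : ℕ) : Bool := arccosLeB q (min ((k : ℚ) * δ) (13 / 5))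

/-- **`ladUp q`**: a rung `k ≤ NLAD` with `arccos q ≤ k δ` (binary search on `upOK`; `NLAD`, which
is certified since `NLAD δ ≥ 3.1416`, if the search fails). [folklore] -/
def ladUp (q : ℚ) : ℕ :=
  let k := bsearchMin (upOK q) (NLAD + 1) 0 NLAD
  if upOK q k then k else NLAD

/-- **`ladDown q`**: a rung `k` with `k δ ≤ arccos q` (`ladderDown` of
`KissingArccosBrackets.lean`). [folklore] -/
def ladDown (q : ℚ) : ℕ := ladderDown δ NLAD q

/-- **The basic bracket of a slot** over a triple of symbols (`a`, `b` the sides at the vertex,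
`c` the opposite side): `NOBR` if the circumradius polynomial is certified `≤ 0` on the box,
otherwise the ladder bracket of `arccos` of the enclosed quotient. [folklore] -/
def basic (a b c : ℕ) : ℕ :=
  match pExpr.enclose PREC ITERS (symBox a b c) with
  | none => mkBr 0 NLAD
  | some P =>
    if P.snd ≤ 0 then NOBR
    else
      match qExpr.enclose PREC ITERS (symBox a b c) with
      | none => mkBr 0 NLAD
      | some Q => mkBr (ladDown (dyCeil PREC Q.snd)) (ladUp (dyFloor PREC Q.fst))

/-- Number of symbols `K + 1`. [folklore] -/
def NS : ℕ := K + 1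

/-- The table of basic brackets, flat index `(a * NS + b) * NS + c`. [folklore] -/
def BTAB : Array ℕ := Array.ofFn (n := NS * NS * NS) fun i =>
  basic (i.1 / (NS * NS)) ((i.1 / NS) % NS) (i.1 % NS)

/-- Lookup in `BTAB`. [folklore] -/
def btab (a b c : ℕ) : ℕ := BTAB.getD ((a * NS + b) * NS + c) NOBR

/-- A side DOMAIN code: `0` = contact; `1 + 16 lo + hi` = long side with cosine in the cells
`lo … hi` (`1 ≤ lo ≤ hi ≤ K`); `UNL` = not yet labelled. [folklore] -/
def UNL : ℕ := 4096
/-- Range code of cells `lo … hi`. [folklore] -/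
def mkR (lo hi : ℕ) : ℕ := 1 + 16 * lo + hi
/-- Lower cell of a range code. [folklore] -/
def rLo (r : ℕ) : ℕ := (r - 1) / 16
/-- Upper cell of a range code. [folklore] -/
def rHi (r : ℕ) : ℕ := (r - 1) % 16
/-- The full long range. [folklore] -/
def FULLR : ℕ := mkR 1 K

/-- Fold `f` over `i, i+1, …, i+n-1`. [folklore] -/
def foldRange {β : Type} (f : β → ℕ → β) : ℕ → ℕ → β → β
  | _, 0, acc => acc
  | i, n + 1, acc => foldRange f (i + 1) n (f acc i)

/-- Fold over the symbols of a domain code (contact ↦ the symbol `0`). [folklore] -/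
def foldSyms {β : Type} (f : β → ℕ → β) (r : ℕ) (acc : β) : β :=
  if r = 0 then f acc 0 else foldRange f (rLo r) (rHi r + 1 - rLo r) acc

/-- Bracket over an opposite-side domain for fixed vertex-side symbols. [folklore] -/
def rangeC (a b r : ℕ) : ℕ := foldSyms (fun acc c => brHull acc (btab a b c)) r NOBR

/-- Table of `rangeC`, flat index `(a * NS + b) * 256 + (16 lo + hi)`, the contact domain at
`(0, 0)`. [folklore] -/
def T1TAB : Array ℕ := Array.ofFn (n := NS * NS * 256) fun i =>
  let ab := i.1 / 256
  let lh := i.1 % 256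
  if lh = 0 then rangeC (ab / NS) (ab % NS) 0 else rangeC (ab / NS) (ab % NS) (mkR (lh / 16) (lh % 16))

/-- Lookup in `T1TAB` by the domain code of the opposite side. [folklore] -/
def t1 (a b r : ℕ) : ℕ :=
  T1TAB.getD ((a * NS + b) * 256 + (if r = 0 then 0 else 16 * rLo r + rHi r)) NOBR

/-- **Bracket of a slot over three side domains** (`ra`, `rb` at the vertex, `rc` opposite).
[folklore] -/
def rangeBr (ra rb rc : ℕ) : ℕ :=
  if ra = 0 then (if rb = 0 then t1 0 0 rc else foldSyms (fun acc b => brHull acc (t1 0 b rc)) rb NOBR)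
  else if rb = 0 then foldSyms (fun acc a => brHull acc (t1 a 0 rc)) ra NOBR
  else foldSyms (fun acc a => foldSyms (fun acc' b => brHull acc' (t1 a b rc)) rb acc) ra NOBR

/-- The smallest lower end of any feasible basic bracket: a lower bound for every angle of
every fan triangle. [folklore] -/
def THMIN : ℕ := BTAB.foldl (fun m br => if br = NOBR then m else min m (brLo br)) NLAD

/-- The first cell reaching nonnegative cosines: `gridPt 10 < 0 ≤ gridPt 11`, so a cosine `≥ 0`
lies in a cell `≥ 11` (`gridPt_neg` in `KissingSearchRules.lean`). [folklore] -/
def ZCELL : ℕ := 11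

/-! ### Part B. States, propagation, search -/

/-- A search state: the placed triangles (codes `256 a + 16 b + c`, `a < b < c < 12`), the
domain code of every side `{a, b}` (index `12 a + b`, `a < b`), and the number of placed
triangles on every side (same indexing; a cache of `tris`). [folklore] -/
structure St where
  /-- placed triangles -/
  tris : Array ℕ
  /-- side domains -/
  dom : Array ℕ
  /-- side counts -/
  sc : Array ℕ
  deriving Inhabited

/-- Triangle code. [folklore] -/
def triCode (a b c : ℕ) : ℕ := 256 * a + 16 * b + c
/-- First vertex of a triangle code. [folklore] -/
def tv0 (t : ℕ) : ℕ := t / 256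
/-- Second vertex. [folklore] -/
def tv1 (t : ℕ) : ℕ := (t / 16) % 16
/-- Third vertex. [folklore] -/
def tv2 (t : ℕ) : ℕ := t % 16
/-- Whether `v` is a vertex of the triangle code `t`. [folklore] -/
def tmem (t v : ℕ) : Bool := tv0 t == v || tv1 t == v || tv2 t == v
/-- Sorted triangle code of three labels. [folklore] -/
def sortTri (a b c : ℕ) : ℕ :=
  let lo := min a (min b c)
  let hi := max a (max b c)
  triCode lo (a + b + c - lo - hi) hi
/-- The two other vertices of a triangle code seen from `v`. [folklore] -/
def others (t v : ℕ) : ℕ × ℕ :=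
  if tv0 t = v then (tv1 t, tv2 t) else if tv1 t = v then (tv0 t, tv2 t) else (tv0 t, tv1 t)

/-- Side index of `{a, b}`. [folklore] -/
def sIdx (a b : ℕ) : ℕ := if a < b then 12 * a + b else 12 * b + a
/-- Domain of a side. [folklore] -/
def St.gdom (s : St) (a b : ℕ) : ℕ := s.dom.getD (sIdx a b) UNL
/-- Set the domain of a side. [folklore] -/
def St.sdom (s : St) (a b r : ℕ) : St := { s with dom := s.dom.setIfInBounds (sIdx a b) r }
/-- Cached number of placed triangles on the side `{a, b}`. [folklore] -/
def St.gsc (s : St) (a b : ℕ) : ℕ := s.sc.getD (sIdx a b) 0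
/-- Twice the number of placed triangles at `v` (sum of the side counts at `v`). [folklore] -/
def St.hdeg2 (s : St) (v : ℕ) : ℕ := foldRange (fun n u => if u = v then n else n + s.gsc v u) 0 12 0
/-- Number of contact sides at `v`. [folklore] -/
def St.cdeg (s : St) (v : ℕ) : ℕ := foldRange (fun n u => if u ≠ v ∧ s.gdom u v = 0 then n + 1 else n) 0 12 0
/-- Number of sides labelled long. [folklore] -/
def St.nlong (s : St) : ℕ :=
  foldRange (fun n i => if i / 12 < i % 12 then
    (let r := s.dom.getD i UNL; if r ≠ 0 ∧ r ≠ UNL then n + 1 else n) else n) 0 144 0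
/-- Number of used labels (labels with a placed triangle). [folklore] -/
def St.nused (s : St) : ℕ := foldRange (fun n v => if s.hdeg2 v = 0 then n else n + 1) 0 12 0

/-- Bracket of the slot of triangle `t` at its vertex `v`. [folklore] -/
def St.slotBr (s : St) (t v : ℕ) : ℕ :=
  let p := others t v
  rangeBr (s.gdom v p.1) (s.gdom v p.2) (s.gdom p.1 p.2)

/-- The link neighbours of `a` in the placed link of `v`. [folklore] -/
def St.linkNbrs (s : St) (v a : ℕ) : List ℕ :=
  s.tris.foldl (fun l t =>
    if tmem t v && tmem t a && a != v then
      (let p := others t v; (if p.1 = a then p.2 else p.1) :: l)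
    else l) []

/-- Labels reachable from the front in the placed link of `v` (fuel-bounded search). [folklore] -/
def St.linkReach (s : St) (v : ℕ) : ℕ → List ℕ → List ℕ → List ℕ
  | 0, seen, _ => seen
  | _ + 1, seen, [] => seen
  | fuel + 1, seen, x :: front =>
    let nb := (s.linkNbrs v x).filter fun y => !(seen.contains y)
    s.linkReach v fuel (nb ++ seen) (nb ++ front)

/-- Link summary of `v` from the side counts: (number of link vertices, number of endpoints
= sides in exactly one triangle, some side in `≥ 3` triangles, the list of link vertices).
[folklore] -/
def St.linkSummary (s : St) (v : ℕ) : ℕ × ℕ × Bool × List ℕ :=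
  foldRange (fun (acc : ℕ × ℕ × Bool × List ℕ) u =>
    if u = v then acc
    else
      let c := s.gsc v u
      if c = 0 then acc
      else (acc.1 + 1, (if c = 1 then acc.2.1 + 1 else acc.2.1), (acc.2.2.1 || decide (3 ≤ c)),
        u :: acc.2.2.2)) 0 12 (0, 0, false, [])

/-- A list `C` of link vertices of `v` is CLOSED under the placed link: with `x` it contains the
other vertex of every placed triangle through `{v, x}`. [folklore] -/
def St.linkClosed (s : St) (v : ℕ) (C : List ℕ) : Bool :=
  C.all fun x => (s.linkNbrs v x).all fun y => C.contains y

/-- The placed link of `v` is inconsistent with a single-cycle link: a side in `≥ 3` triangles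
(`bad`), or a set `C` of link vertices closed under the placed link, all of whose sides at `v`
lie in two placed triangles, that misses a link vertex (a closed cycle plus more).  The candidate
sets `C` are the search components of the link vertices `verts`, each verified closed before
use. [folklore] -/
def St.badLink (s : St) (v : ℕ) (verts : List ℕ) (bad : Bool) : Bool :=
  bad || (verts.foldl (fun (acc : List ℕ × Bool) a =>
    if acc.2 || acc.1.contains a then acc
    else
      let C := s.linkReach v 24 [a] [a]
      (C ++ acc.1, s.linkClosed v C && C.all (fun x => s.gsc v x == 2) && verts.any fun z => !(C.contains z)))
    ([], false)).2

/-- First index `i ∈ [lo, lo + n)` satisfying `ok`, if any. [folklore] -/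
def firstOk (ok : ℕ → Bool) : ℕ → ℕ → Option ℕ
  | _, 0 => none
  | lo, n + 1 => if ok lo then some lo else firstOk ok (lo + 1) n
/-- Last index `i ∈ (hi - n, hi]` satisfying `ok`, if any. [folklore] -/
def lastOk (ok : ℕ → Bool) : ℕ → ℕ → Option ℕ
  | _, 0 => none
  | hi, n + 1 => if ok hi then some hi else lastOk ok (hi - 1) n

/-- Trim the domain of one side of the slot `(t, v)` (role `0`: side `{v,a}`, `1`: `{v,b}`,
`2`: `{a,b}`) to the cells whose bracket is feasible and meets the window `[wlo, whi]`,
removing cells from the two ends only; `none` if nothing is left. [cite: Moore1966, §4.4] -/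
def St.trimSide (s : St) (t v role wlo whi : ℕ) : Option St :=
  let p := others t v
  let a := p.1
  let b := p.2
  let ra := s.gdom v a
  let rb := s.gdom v b
  let rc := s.gdom a b
  let r := if role = 0 then ra else if role = 1 then rb else rc
  if r = 0 ∨ r = UNL then some s
  else
    let ok : ℕ → Bool := fun c =>
      let rr := mkR c c
      let br := if role = 0 then rangeBr rr rb rc else if role = 1 then rangeBr ra rr rc else rangeBr ra rb rr
      br != NOBR && brLo br ≤ whi && wlo ≤ brHi br
    let lo := rLo r
    let hi := rHi r
    match firstOk ok lo (hi + 1 - lo) with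
    | none => none
    | some lo' =>
      match lastOk ok hi (hi + 1 - lo') with
      | none => none
      | some hi' =>
        let r' := mkR lo' hi'
        if r' = r then some s
        else some (if role = 0 then s.sdom v a r' else if role = 1 then s.sdom v b r' else s.sdom a b r')

/-- The apexes (third vertices) of the placed triangles on the side `{a, b}`. [folklore] -/
def St.apexes (s : St) (a b : ℕ) : List ℕ :=
  s.tris.foldl (fun l t => if tmem t a && tmem t b then (tv0 t + tv1 t + tv2 t - a - b) :: l else l) []

/-- The placed triangles at `v`. [folklore] -/
def St.trisAt (s : St) (v : ℕ) : List ℕ := s.tris.foldr (fun t l => if tmem t v then t :: l else l) []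

/-- Sum of the lower / upper ends of the slot brackets at `v` over the given triangles at `v`
(`none` if a slot is infeasible). [folklore] -/
def St.slotSums (s : St) (v : ℕ) (tv : List ℕ) : Option (ℕ × ℕ) :=
  tv.foldl (fun acc t =>
    match acc with
    | none => none
    | some (sl, sh) =>
      (let br := s.slotBr t v; if br = NOBR then none else some (sl + brLo br, sh + brHi br))) (some (0, 0))

/-- Window trimming of the slots at a closed label `v` (triangles `tv` at `v`), given the sums
`sl, sh` of the lower / upper ends of the slot brackets at `v` in `s` (brackets of `s` are
valid for every narrowing of `s`, so the windows computed from them stay sound while the state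
is trimmed). [folklore] -/
def St.trimAt (s : St) (v sl sh : ℕ) (tv : List ℕ) : Option St :=
  tv.foldl (fun os t =>
    match os with
    | none => none
    | some s1 =>
      let br := s.slotBr t v
      if br = NOBR then none
      else
        let wlo := TWOPI_LO - (sh - brHi br)
        let whi := TWOPI_HI - (sl - brLo br)
        match s1.trimSide t v 0 wlo whi with
        | none => none
        | some s2 => match s2.trimSide t v 1 wlo whi with
          | none => none
          | some s3 => s3.trimSide t v 2 wlo whi) (some s)

/-- **The node rule at `v`**: nothing if `v` has no triangle; kill on an inconsistent link or an
infeasible slot; at a CLOSED label (every side at `v` in `0` or `2` placed triangles: under the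
single-cycle link axiom all triangles at `v` are then placed) require `Σ lo < 12868`,
`12867 ≤ Σ hi` and trim the windows; at an open one require `Σ lo + THMIN < 12868`.
[cite: Hales2012, proof of Lemma 9 (node equations)] -/
def St.nodeRule (s : St) (v : ℕ) : Option St :=
  let (nv, ne, bad, verts) := s.linkSummary v
  if nv = 0 then some s
  else if s.badLink v verts bad then none
  else
    let tv := s.trisAt v
    match s.slotSums v tv with
    | none => none
    | some (sl, sh) =>
      if ne = 0 then
        (if TWOPI_HI ≤ sl ∨ sh < TWOPI_LO then none else s.trimAt v sl sh tv)
      else if TWOPI_HI ≤ sl + THMIN then none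
      else some s

/-- Feasibility trimming of the three sides of every placed triangle at `v`. [folklore] -/
def St.trimTrisAt (s : St) (v : ℕ) : Option St :=
  (s.trisAt v).foldl (fun os t =>
    match os with
    | none => none
    | some s =>
      match s.trimSide t (tv0 t) 0 0 NLAD with
      | none => none
      | some s => match s.trimSide t (tv0 t) 1 0 NLAD with
        | none => none
        | some s => s.trimSide t (tv0 t) 2 0 NLAD) (some s)

/-- The pairing rule on one side `{a, b}`. [cite: Hales2012, proof of Theorem 2] -/
def St.pairRuleAt (s : St) (a b : ℕ) : Option St :=
  let r := s.gdom a b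
  if r = 0 ∨ r = UNL ∨ s.gsc a b ≠ 2 then some s
  else
    let ap := s.apexes a b
    if ap.length = 2 ∧ ap.all fun w => s.gdom w a == 0 && s.gdom w b == 0 then
      let lo := max (rLo r) ZCELL
      if rHi r < lo then none
      else if lo = rLo r then some s else some (s.sdom a b (mkR lo (rHi r)))
    else some s

/-- The pairing rule on all sides at `v`. [folklore] -/
def St.pairRulesAt (s : St) (v : ℕ) : Option St :=
  foldRange (fun os u => match os with
    | none => none
    | some s => if u = v then some s else s.pairRuleAt u v) 0 12 (some s)

/-- The local propagation step at `v`: triangle trims at `v`, pairing at `v`, node rule at `v`.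
[folklore] -/
def St.localStep (s : St) (v : ℕ) : Option St :=
  match s.trimTrisAt v with
  | none => none
  | some s => match s.pairRulesAt v with
    | none => none
    | some s => s.nodeRule v

/-- The labels whose rules depend on the side `i` (its endpoints and the apexes of its placed
triangles). [folklore] -/
def St.depsOfSide (s : St) (i : ℕ) : List ℕ :=
  let a := i / 12
  let b := i % 12
  a :: b :: s.apexes a b

/-- The labels affected by the domain changes from `s` to `s'` made by a local step at `v`
(only sides of triangles at `v` can have changed). [folklore] -/
def St.dirtyFrom (s s' : St) (v : ℕ) : List ℕ :=
  (s'.trisAt v).foldl (fun acc t =>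
    let f := fun (acc : List ℕ) (p q : ℕ) =>
      if s.gdom p q = s'.gdom p q then acc
      else (s'.depsOfSide (sIdx p q)).foldl (fun acc u => if acc.contains u then acc else u :: acc) acc
    f (f (f acc (tv0 t) (tv1 t)) (tv0 t) (tv2 t)) (tv1 t) (tv2 t)) []

/-- **Propagation** (worklist form): apply the local step at dirty labels until none is left
(at most `fuel` steps); a domain change makes the dependent labels dirty. [cite: Moore1966, §4.4] -/
def St.propagateWL (s : St) : ℕ → List ℕ → Option St
  | 0, _ => some s
  | _ + 1, [] => some s
  | fuel + 1, v :: rest =>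
    if 12 ≤ v then s.propagateWL fuel rest
    else
      match s.localStep v with
      | none => none
      | some s' =>
        let newDirty := (s.dirtyFrom s' v).filter fun u => !(rest.contains u)
        s'.propagateWL fuel (rest ++ newDirty)

/-- Propagation from scratch (every used label dirty). [folklore] -/
def St.propagate (s : St) (fuel : ℕ) : Option St :=
  s.propagateWL fuel ((List.range 12).filter fun v => s.hdeg2 v != 0)

/-- Add a triangle (rejecting duplicates and third triangles on a side). [folklore] -/
def St.addTri (s : St) (a b c : ℕ) : Option St :=
  let t := sortTri a b c
  if s.tris.contains t then none
  else
    let sc := ((s.sc.modify (sIdx a b) (· + 1)).modify (sIdx a c) (· + 1)).modify (sIdx b c) (· + 1)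
    let s' : St := ⟨s.tris.push t, s.dom, sc⟩
    if 2 < s'.gsc a b ∨ 2 < s'.gsc a c ∨ 2 < s'.gsc b c then none else some s'

/-- The contact adjacency of a state (sides with domain `0` lying in a placed triangle).
[folklore] -/
def St.adjB (s : St) (a b : ℕ) : Bool := a != b && s.gsc a b != 0 && s.gdom a b == 0

/-- `perm` (a list of `12` images) is a bijection of `Fin 12` carrying the contact graph of `s`
onto the pattern graph `tameAdjM i`. [folklore] -/
def St.isoTo (s : St) (i : Fin 8) (perm : List ℕ) : Bool :=
  perm.length == 12 &&
  (List.range 12).all (fun a => (List.range 12).all fun b => a == b || perm.getD a 12 != perm.getD b 12) &&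
  (List.range 12).all fun a => (List.range 12).all fun b =>
    if h : perm.getD a 12 < 12 ∧ perm.getD b 12 < 12 then
      s.adjB a b == tameAdjM i ⟨perm.getD a 12, h.1⟩ ⟨perm.getD b 12, h.2⟩
    else false

/-- Backtracking search for such a bijection (images of `0, 1, …` in turn). [folklore] -/
def St.findIso (s : St) (i : Fin 8) : ℕ → List ℕ → Option (List ℕ)
  | 0, _ => none
  | fuel + 1, acc =>
    let k := acc.length
    if 12 ≤ k then (if s.isoTo i acc then some acc else none)
    else
      (List.range 12).findSome? fun img =>
        if acc.contains img then none
        else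
          let ok := (List.range k).all fun a =>
            if h : acc.getD a 12 < 12 ∧ img < 12 then
              s.adjB a k == tameAdjM i ⟨acc.getD a 12, h.1⟩ ⟨img, h.2⟩
            else false
          if ok then s.findIso i fuel (acc ++ [img]) else none

/-- Accept a complete leaf: its contact graph is FCC (`tameAdjM 1`) or HCP (`tameAdjM 0`) by a
verified bijection. [cite: Hales2012, Lemma 9] -/
def St.accept (s : St) : Bool :=
  match s.findIso 1 20 [] with
  | some p => s.isoTo 1 p
  | none => match s.findIso 0 20 [] with
    | some p => s.isoTo 0 p
    | none => false

/-- The widest long side lying in a placed triangle (by number of cells), if one has `≥ 2`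
cells. [folklore] -/
def St.widest (s : St) : Option (ℕ × ℕ) :=
  (foldRange (fun (best : Option (ℕ × ℕ × ℕ)) i =>
    let a := i / 12
    let b := i % 12
    if ¬ a < b then best
    else
      let r := s.gdom a b
      if r = 0 ∨ r = UNL ∨ s.gsc a b = 0 then best
      else
        let w := rHi r - rLo r
        if w = 0 then best
        else match best with
          | none => some (w, a, b)
          | some (w', _, _) => if w' < w then some (w, a, b) else best) 0 144 none).map fun x => x.2

-- The deep fold must not be unfolded by definitional reduction when `refute` matches on it
-- (equation-lemma generation); proofs use its unfolding equation instead.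
attribute [irreducible] St.widest

/-- Refutation of a complete leaf by bisection of long-side ranges: `true` iff every sub-box is
killed by propagation. [cite: Moore1966, §4.4] -/
def St.refute (s : St) : ℕ → Bool
  | 0 => false
  | fuel + 1 =>
    match s.propagate 300 with
    | none => true
    | some s =>
      match s.widest with
      | none => false
      | some (a, b) =>
        let r := s.gdom a b
        let mid := (rLo r + rHi r) / 2
        (s.sdom a b (mkR (rLo r) mid)).refute fuel && (s.sdom a b (mkR (mid + 1) (rHi r))).refute fuel

/-- An OPEN SIDE to grow at: the smallest label `v` with an open side, the smallest `a` with
`{v, a}` in exactly one placed triangle, and the third vertex `b` of that triangle. [folklore] -/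
def St.chooseOpen (s : St) : Option (ℕ × ℕ × ℕ) :=
  (List.range 12).findSome? fun v =>
    match (List.range 12).find? fun a => a != v && s.gsc v a == 1 with
    | none => none
    | some a =>
      match s.apexes v a with
      | b :: _ => some (v, a, b)
      | [] => none

/-- The smallest unused label, if any. [folklore] -/
def St.newLabel (s : St) : Option ℕ := (List.range 12).find? fun v => s.hdeg2 v == 0

/-- Number of sides at `v` labelled long. [folklore] -/
def St.nlongAt (s : St) (v : ℕ) : ℕ :=
  foldRange (fun n u => if u ≠ v ∧ s.gdom v u ≠ 0 ∧ s.gdom v u ≠ UNL then n + 1 else n) 0 12 0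

/-- **The reflection tie-break** of the root normalisation: the label types (contact `0` /
long `1`) satisfy `(t₀₃, t₁₃) ≤ (t₀₄, t₂₄)` lexicographically; a state violating it with all
four sides labelled is killed. [folklore] -/
def St.tbKill (s : St) : Bool :=
  let d03 := s.gdom 0 3
  let d13 := s.gdom 1 3
  let d04 := s.gdom 0 4
  let d24 := s.gdom 2 4
  d03 != UNL && d13 != UNL && d04 != UNL && d24 != UNL &&
    (let t03 := if d03 = 0 then 0 else 1
     let t13 := if d13 = 0 then 0 else 1
     let t04 := if d04 = 0 then 0 else 1
     let t24 := if d24 = 0 then 0 else 1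
     decide (t04 < t03) || (t03 == t04 && decide (t24 < t13)))

/-- Counting kills after growing at `(v, a, c)`: more than `4` contacts at one of the three
labels, more than `7` long sides, more than one long side at the root label `0`, or the
tie-break. [cite: Hales2012, Lemma 7; Theorem 3 (proof)] -/
def St.countKill (s : St) (v a c : ℕ) : Bool :=
  4 < s.cdeg v || 4 < s.cdeg a || 4 < s.cdeg c || 7 < s.nlong || 1 < s.nlongAt 0 || s.tbKill

/-- The root label `0` is closed (every side at `0` lies in `0` or `2` placed triangles) but does
not show its four contacts: kill. [folklore] -/
def St.rootKill (s : St) : Bool :=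
  let (nv, ne, _, _) := s.linkSummary 0
  nv != 0 && ne == 0 && s.cdeg 0 != 4

/-- The label options of a side `{p, c}` of the new triangle in state `s`: its present label if
it has one, else the sublist of `[0 (contact), FULLR (long)]` not immediately excluded by the
counting rules (an empty list means the growth step is dead). [folklore] -/
def St.labelOpts (s : St) (p c : ℕ) : List ℕ :=
  if s.gdom p c ≠ UNL then [s.gdom p c]
  else (if s.cdeg p < 4 ∧ s.cdeg c < 4 then [0] else []) ++ (if s.nlong < 7 then [FULLR] else [])

/-- One level of the search tree: a decided leaf, or the children (states with their dirty
labels). [folklore] -/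
inductive Node
  /-- a decided node -/
  | leaf (b : Bool) : Node
  /-- an internal node -/
  | branch (kids : List (St × List ℕ)) : Node

/-- The children of a state grown at the open side `{v, a}` through the third vertex `c`:
one per admissible labelling of the new sides, minus the count-killed ones. [folklore] -/
def St.kidsAt (s : St) (v a c : ℕ) : List (St × List ℕ) :=
  match s.addTri v a c with
  | none => []
  | some s' =>
    (s.labelOpts v c).flatMap fun r1 => (s.labelOpts a c).filterMap fun r2 =>
      let s'' := (s'.sdom v c r1).sdom a c r2
      if s''.countKill v a c then none else some (s'', [v, a, c])

/-- **One level of the search.**  Propagate (dirty labels `dirty`); kill at a closed root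
without its four contacts; if no open side is left, the placed triangles must be all twenty on
all twelve labels and the leaf is accepted (FCC/HCP) or refuted by bisection; otherwise grow
at the chosen open side `{v, a}` over every third vertex `c` (an old label with room on
`{v,c}`, `{a,c}`, or the smallest new label) and every labelling of the new sides. [folklore] -/
def St.expand (s : St) (dirty : List ℕ) : Node :=
  match s.propagateWL 400 dirty with
  | none => .leaf true
  | some s =>
    if s.rootKill then .leaf true
    else
      match s.chooseOpen with
      | none =>
        .leaf (if s.tris.size != 20 || s.nused != 12 then true
          else if s.accept then true
          else s.refute 40)
      | some (v, a, b) =>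
        if 20 ≤ s.tris.size then .leaf true
        else
          .branch
            (((List.range 12).filter fun c =>
                !(c == v || c == a || c == b || s.hdeg2 c == 0 || 2 ≤ s.gsc v c || 2 ≤ s.gsc a c)).flatMap
                (fun c => s.kidsAt v a c) ++
              (match s.newLabel with
                | none => []
                | some n => s.kidsAt v a n))

/-- **The search**: `true` means every structure consistent with the state has an FCC or HCP
contact graph (`KissingSearchSearch.lean`). [folklore] -/
def St.search (s : St) (dirty : List ℕ) : ℕ → Bool
  | 0 => false
  | fuel + 1 =>
    match s.expand dirty with
    | .leaf b => b
    | .branch kids => kids.all fun p => p.1.search p.2 fuel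

/-- The empty state. [folklore] -/
def St.empty : St := ⟨#[], Array.replicate 144 UNL, Array.replicate 144 0⟩

/-- **The root states.**  Label `0` (the normalised vertex: four contacts, at most one long
side) with the triangles `{0,1,2}`, `{0,1,3}`, `{0,2,4}`, the spokes `{0,1}`, `{0,2}` contacts,
the rim `{1,2}` of type `m`, and the sides `{0,3}`, `{1,3}`, `{0,4}`, `{2,4}` of the types given
by the bits of `bits` (`0` = contact, `1` = long).  (Written with plain array updates, so that
the kernel can evaluate it.) [folklore] -/
def mkRoot (m bits : ℕ) : St :=
  let lab : ℕ → ℕ := fun t => if t = 0 then 0 else FULLR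
  let sc : Array ℕ := (((((((Array.replicate 144 0).setIfInBounds (sIdx 0 1) 2).setIfInBounds (sIdx 0 2) 2).setIfInBounds
    (sIdx 1 2) 1).setIfInBounds (sIdx 0 3) 1).setIfInBounds (sIdx 1 3) 1).setIfInBounds (sIdx 0 4) 1).setIfInBounds (sIdx 2 4) 1
  let s0 : St := ⟨#[triCode 0 1 2, triCode 0 1 3, triCode 0 2 4], Array.replicate 144 UNL, sc⟩
  ((((((s0.sdom 0 1 0).sdom 0 2 0).sdom 1 2 (lab m)).sdom 0 3 (lab (bits % 2))).sdom 1 3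
    (lab ((bits / 2) % 2))).sdom 0 4 (lab ((bits / 4) % 2))).sdom 2 4 (lab ((bits / 8) % 2))

/-- The admissible root parameters: not two long spokes, and the tie-break. [folklore] -/
def rootOK (bits : ℕ) : Bool :=
  let t03 := bits % 2
  let t13 := (bits / 2) % 2
  let t04 := (bits / 4) % 2
  let t24 := (bits / 8) % 2
  !(t03 == 1 && t04 == 1) && !(decide (t04 < t03) || (t03 == t04 && decide (t24 < t13)))

/-- **All root states** (fourteen), each with every label dirty. [folklore] -/
def rootStates : List (St × List ℕ) :=
  (List.range 2).flatMap fun m => ((List.range 16).filter rootOK).map fun bits => (mkRoot m bits, [0, 1, 2, 3, 4])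

/-- Expand every node of a list one level: `none` if a leaf is `false`; decided `true` leaves
disappear; internal nodes are replaced by their children. [folklore] -/
def stepAll : List (St × List ℕ) → Option (List (St × List ℕ))
  | [] => some []
  | p :: rest =>
    match p.1.expand p.2 with
    | .leaf true => stepAll rest
    | .leaf false => none
    | .branch kids => (stepAll rest).map fun L => kids ++ L

/-- The frontier at depth `k`. [folklore] -/
def frontier (L : List (St × List ℕ)) : ℕ → Option (List (St × List ℕ))
  | 0 => some L
  | k + 1 =>
    match stepAll L with
    | none => none
    | some L' => frontier L' k

/-- Attach indices. [folklore] -/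
def indexed {α : Type} (L : List α) : List (ℕ × α) := (List.range L.length).zip L

/-- **Part `i` of `parts` of the whole computation**: the nodes of the frontier at depth
`depth` whose index is `≡ i (mod parts)` are searched with fuel `fuel`. [folklore] -/
def checkPart (depth parts i fuel : ℕ) : Bool :=
  match frontier rootStates depth with
  | none => false
  | some L => (indexed L).all fun p => p.1 % parts != i || p.2.1.search p.2.2 fuel

/-- The whole computation in one piece (for reference; the run is split into parts).
[folklore] -/
def checkAll (fuel : ℕ) : Bool := rootStates.all fun p => p.1.search p.2 fuel

end KissingSearch

end Literature.Geometry.DiscreteGeometry
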